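import Mathlib

/-!
# Blocks missing a point set: the second-moment bound
# (crux `LevelGradedCohnUmans.GradedDesignFamily`, stmt-MatrixMultiplication-7610; negative side,
# line `quadratic-extension-level-one-cell`, stub `card_disjoint_blocks_le`)

Let `inc ⊆ P × B` be a finite incidence structure in which every point is on exactly `r` blocks
and every two distinct points are on exactly `μ` common blocks (e.g. points and lines of
`PG(3, q)`: `r = q² + q + 1`, `μ = 1`).  Then for every nonempty point set `A`, `a := |A|`,

* `card_disjoint_blocks_le` — the number of blocks missing `A` is at most
  `|B| - a r² / (r + (a - 1) μ)`.

PROOF (second moment / Cauchy–Schwarz).  For a block `b` let `m_b := #{p ∈ A : inc p b}`.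
Double counting gives `Σ_b m_b = a r` (flags `(p, b)` with `p ∈ A`) and
`Σ_b m_b² = a (r + (a - 1) μ)` (ordered pairs `(p, p') ∈ A²` both on `b`: the diagonal contributes
`a r`, each of the `a (a - 1)` off-diagonal pairs contributes `μ`).  If `T` is the set of blocks
meeting `A` (`m_b ≠ 0`), Cauchy–Schwarz on `T` gives `(a r)² = (Σ_{b ∈ T} m_b)² ≤ |T| Σ_b m_b²
= |T| a (r + (a - 1) μ)`, so `|T| ≥ a r² / (r + (a - 1) μ)` (trivially if the denominator
vanishes, the quotient then being `0`), and the blocks missing `A` are the complement of `T`.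

This is the "avoidance" half of the flat-size lemma of the line's negative programme: lines of
`PG(3, q)` missing a set of `c q³` points number at most `q³ / c` (up to lower-order terms).

Sorry-free; axioms `propext`, `Classical.choice`, `Quot.sound`.
-/

set_option linter.dupNamespace false

open scoped BigOperators

namespace Summit.MatrixMultiplication.MatrixMultiplication.Theorems.GradedDesignFamily.Negative

/-- **Blocks missing a point set (second-moment bound).**  In a finite incidence structure in
which every point is on `r` blocks and every two distinct points are on `μ` common blocks, the
number of blocks containing no point of a nonempty point set `A` is at most
`|B| - |A| r² / (r + (|A| - 1) μ)`. [folklore] -/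
theorem card_disjoint_blocks_le {P B : Type} [Fintype P] [Fintype B] [DecidableEq P]
    [DecidableEq B] (inc : P → B → Prop) [∀ p b, Decidable (inc p b)] (r μ : ℕ)
    (hr : ∀ p : P, (Finset.univ.filter fun b => inc p b).card = r)
    (hμ : ∀ p p' : P, p ≠ p' → (Finset.univ.filter fun b => inc p b ∧ inc p' b).card = μ)
    (A : Finset P) (hA : A.Nonempty) :
    ((Finset.univ.filter fun b : B => ∀ p ∈ A, ¬ inc p b).card : ℝ) ≤
      Fintype.card B - (A.card : ℝ) * (r : ℝ) ^ 2 / ((r : ℝ) + ((A.card : ℝ) - 1) * (μ : ℝ)) := by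
  classical
  -- multiplicities `m b = #{p ∈ A : inc p b}`
  obtain ⟨m, hm⟩ : ∃ m : B → ℕ, ∀ b, m b = (A.filter fun p => inc p b).card := ⟨_, fun _ => rfl⟩
  -- (i) first moment: flags `(p, b)`, `p ∈ A`
  have h1 : ∑ b, m b = A.card * r := by
    calc ∑ b, m b = ∑ b, ∑ p ∈ A, if inc p b then 1 else 0 :=
          Finset.sum_congr rfl fun b _ => by rw [hm, Finset.card_filter]
      _ = ∑ p ∈ A, ∑ b, if inc p b then 1 else 0 := Finset.sum_comm
      _ = ∑ p ∈ A, r := Finset.sum_congr rfl fun p _ => by rw [← Finset.card_filter, hr p]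
      _ = A.card * r := by rw [Finset.sum_const, smul_eq_mul]
  -- (ii) second moment: ordered pairs `(p, p') ∈ A²` on a common block
  have h2 : ∑ b, m b ^ 2 = A.card * (r + (A.card - 1) * μ) := by
    calc ∑ b, m b ^ 2 = ∑ b, ∑ p ∈ A, ∑ p' ∈ A, if inc p b ∧ inc p' b then 1 else 0 := by
          refine Finset.sum_congr rfl fun b _ => ?_
          rw [sq, hm, Finset.card_filter, Finset.sum_mul_sum]
          refine Finset.sum_congr rfl fun p _ => Finset.sum_congr rfl fun p' _ => ?_
          rw [ite_zero_mul_ite_zero, mul_one]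
      _ = ∑ p ∈ A, ∑ b, ∑ p' ∈ A, if inc p b ∧ inc p' b then 1 else 0 := Finset.sum_comm
      _ = ∑ p ∈ A, ∑ p' ∈ A, (Finset.univ.filter fun b => inc p b ∧ inc p' b).card := by
          refine Finset.sum_congr rfl fun p _ => ?_
          rw [Finset.sum_comm]
          exact Finset.sum_congr rfl fun p' _ => (Finset.card_filter _ _).symm
      _ = ∑ p ∈ A, (r + (A.card - 1) * μ) := by
          refine Finset.sum_congr rfl fun p hp => ?_
          rw [← Finset.add_sum_erase A _ hp]
          congr 1
          · rw [← hr p]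
            exact congrArg Finset.card (Finset.filter_congr fun b _ => and_self_iff)
          · rw [Finset.sum_congr rfl fun p' hp' => hμ p p' (Finset.ne_of_mem_erase hp').symm,
              Finset.sum_const, smul_eq_mul, Finset.card_erase_of_mem hp]
      _ = A.card * (r + (A.card - 1) * μ) := by rw [Finset.sum_const, smul_eq_mul]
  -- (iii) Cauchy–Schwarz on the blocks meeting `A`
  have hT1 : ∑ b ∈ Finset.univ.filter (fun b => m b ≠ 0), m b = ∑ b, m b :=
    Finset.sum_filter_ne_zero _
  have hT2 : ∑ b ∈ Finset.univ.filter (fun b => m b ≠ 0), m b ^ 2 = ∑ b, m b ^ 2 :=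
    Finset.sum_filter_of_ne fun b _ h => fun h0 => h (by rw [h0]; rfl)
  have hCS : (A.card * r) ^ 2 ≤
      (Finset.univ.filter fun b => m b ≠ 0).card * (A.card * (r + (A.card - 1) * μ)) := by
    rw [← h1, ← h2, ← hT1, ← hT2]
    exact sq_sum_le_card_mul_sum_sq
  -- (iv) the blocks missing `A` are the blocks `b` with `m b = 0`
  have hD : (Finset.univ.filter fun b : B => ∀ p ∈ A, ¬ inc p b) =
      Finset.univ.filter fun b => ¬ (m b ≠ 0) := by
    refine Finset.filter_congr fun b _ => ?_
    rw [not_not, hm, Finset.card_eq_zero, Finset.filter_eq_empty_iff]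
  have hcard : (Finset.univ.filter fun b => m b ≠ 0).card +
      (Finset.univ.filter fun b : B => ∀ p ∈ A, ¬ inc p b).card = Fintype.card B := by
    rw [hD, Finset.card_filter_add_card_filter_not, Finset.card_univ]
  -- (v) real arithmetic
  have ha1 : 1 ≤ A.card := hA.card_pos
  have ha : (0 : ℝ) < A.card := by exact_mod_cast hA.card_pos
  have hCS' : ((A.card : ℝ) * r) ^ 2 ≤
      ((Finset.univ.filter fun b => m b ≠ 0).card : ℝ) * (A.card * (r + (A.card - 1) * μ)) := by
    have h := hCS
    rw [← Nat.cast_le (α := ℝ)] at h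
    push_cast [Nat.cast_sub ha1] at h
    exact h
  have hDcard : ((Finset.univ.filter fun b : B => ∀ p ∈ A, ¬ inc p b).card : ℝ) =
      Fintype.card B - ((Finset.univ.filter fun b => m b ≠ 0).card : ℝ) := by
    rw [← hcard]
    push_cast
    ring
  have key : (A.card : ℝ) * (r : ℝ) ^ 2 / ((r : ℝ) + ((A.card : ℝ) - 1) * (μ : ℝ)) ≤
      ((Finset.univ.filter fun b => m b ≠ 0).card : ℝ) := by
    have hs0 : (0 : ℝ) ≤ (r : ℝ) + ((A.card : ℝ) - 1) * (μ : ℝ) := by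
      have h1le : (1 : ℝ) ≤ A.card := by exact_mod_cast ha1
      have : (0 : ℝ) ≤ ((A.card : ℝ) - 1) * (μ : ℝ) := mul_nonneg (by linarith) (Nat.cast_nonneg μ)
      positivity
    rcases hs0.eq_or_lt with hs | hs
    · rw [← hs, div_zero]
      positivity
    · rw [div_le_iff₀ hs]
      refine le_of_mul_le_mul_left ?_ ha
      calc (A.card : ℝ) * ((A.card : ℝ) * (r : ℝ) ^ 2) = ((A.card : ℝ) * r) ^ 2 := by ring
        _ ≤ _ := hCS'
        _ = _ := by ring
  rw [hDcard]
  linarith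

end Summit.MatrixMultiplication.MatrixMultiplication.Theorems.GradedDesignFamily.Negative
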